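import Literature.Analysis.FluidPDE.HomogeneousEuler
import Literature.Analysis.FluidPDE.SphereIntegral
import Mathlib.MeasureTheory.Measure.Haar.InnerProductSpace
import HarnessLib

/-!
# Vanishing sphere moments `∫_{S²} f Hⁿ dσ = 0` of homogeneous stationary Euler flows (Shvydkoy 2018, Lemma 6.1)

R. Shvydkoy, *Homogeneous solutions to the 3D Euler system*, Trans. Amer. Math. Soc. 370 (2018)
2517–2535 = arXiv:1510.03378 [`Shvydkoy2018`], §6.3 "Absence of flux anomaly" (arXiv pp. 13–14).
For a homogeneous stationary Euler pair `V = (v + f n)/|x|^α`, `P = p/|x|^{2α}` on `ℝ³ ∖ {0}`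
(Shvydkoy (1)–(2); the tree's `IsHomogeneousSteadyEuler α V P`, file `HomogeneousEuler.lean`)
with spherical Bernoulli function `H = |v|² + f² + 2p` on `S²`, the paper proves

* **Lemma 6.1.** "For any `α ∈ ℝ` and smooth solution (2) we have `∫_{S²} f Hⁿ dσ = 0` for all
  `n ∈ ℕ`, and even for `n = 0` if `α ≠ 2`." (Proof: multiply the transport equation
  `v∇H = 2αfH` (Shvydkoy (8)) by `H^{n-1}`, integrate over `S²` and use `(2-α)f + div v = 0`
  (Shvydkoy (6)₁); the exceptional exponent `α = 2/(1+2n₀)` is recovered by an analytic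
  approximation argument; for `α = 2` the radial solution is a counterexample at `n = 0`.)
* the flux formula preceding it (§6.3): at the Onsager-critical degree `α = 2/3` the anomalous
  energy flux of the tapered solution into the point singularity is `Π = -½ ∫_{S²} f H dσ`, hence
  `Π = 0` by the lemma with `n = 1` ("absence of flux anomaly", abstract and §6.3).

In bulk variables on the unit sphere (outward normal `n(x) = x` for `|x| = 1`):
`f(x) = ⟪V x, x⟫` and `H(x) = ‖V x‖² + 2 P(x)`, and `∫_{S²} … dσ` is the tree's
`sphereIntegral volume (…) 1` (`SphereIntegral.lean`: `σ = volume.toSphere`, Mathlib's surface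
measure on the unit sphere; only `= 0` is asserted, so the normalisation of `σ` is immaterial).

## Why it is here

Nearest printed prior art for the route item
`Summit.AnomalousDissipation.AnomalousDissipation.Theses.DyadicWallCascade.HalfSpaceHierarchy`
(stmt-AnomalousDissipation-18627), which asks for a bounded stationary Euler flow on the upper
half-space, invariant under the SINGLE dilation `X ↦ 2X` towards the PLANE `z = 0` and
band-periodic, with NON-ZERO energy flux `F = ∫ V₃(|V|²/2 + Q)` through `{z = 1}`. Lemma 6.1 is
the continuous, point-centred analogue of the "degree-0 flux identity" feared in that item's
`why it might fail`: for flows homogeneous under ALL dilations about a POINT the energy flux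
through spheres vanishes in every degree. It does not decide the item (plane vs point, one
dilation vs all, periodic band vs sphere) and is vendored as a hypothesis for refuters/provers.

## Contents

* `shvydkoy2018_lemma61_sphereMoments` — NAMED FACT (Lemma 6.1, both clauses).
* `shvydkoy2018_lemma61_sphereMoments.flux_moment_eq_zero` — proved corollary, the case `n = 1`
  (`∫_{S²} f H dσ = 0`, i.e. `Π = 0` in (§6.3)).

## Design notes

* "smooth solution" is rendered as `IsHomogeneousSteadyEuler α V P` (the `C¹` class (1)–(2) of
  `HomogeneousEuler.lean`: homogeneity of degrees `-α`, `-2α`, `div V = 0`, `V·∇V + ∇P = 0` off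
  the origin) plus `C^∞` regularity of `V` and `P` on `ℝ³ ∖ {0}` — exactly "`v, f, p ∈ C^∞(S²)`"
  transported to bulk variables (module docstring of `HomogeneousEuler.lean`, Design notes).
* `n ∈ ℕ` in the paper means `n ≥ 1` (the case `n = 0` is listed separately under `α ≠ 2`);
  rendered as `n ≠ 0`, and the `n = 0` clause as `sphereIntegral volume (fun x => ⟪V x, x⟫) 1 = 0`.
* No `sorry`; the fact is a `def … : Prop`; users take `(h : shvydkoy2018_lemma61_sphereMoments)`.

## References

* R. Shvydkoy, Trans. Amer. Math. Soc. 370 (2018) 2517–2535, doi:10.1090/tran/7022 =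
  arXiv:1510.03378, §6.3, Lemma 6.1. [`Shvydkoy2018`]
-/

noncomputable section

open MeasureTheory Set
open scoped InnerProductSpace RealInnerProductSpace

namespace Literature.Analysis.FluidPDE

/-- **Shvydkoy 2018, Lemma 6.1** (Trans. AMS 370 (2018), §6.3 = arXiv:1510.03378 p. 14): "For any
`α ∈ ℝ` and smooth solution (2) we have `∫_{S²} f Hⁿ dσ = 0` for all `n ∈ ℕ`, and even for `n = 0`
if `α ≠ 2`." Here `(V, P)` is a smooth stationary Euler pair on `ℝ³ ∖ {0}`, homogeneous of degrees
`-α` (velocity) and `-2α` (pressure), `f = ⟪V, n⟫` is its normal component and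
`H = |v|² + f² + 2p = ‖V‖² + 2P` its Bernoulli function on the unit sphere `S²`, `dσ` the surface
measure. With `n = 1` this is the vanishing `Π = -½∫_{S²} fH dσ = 0` of the anomalous energy flux
into the point singularity (§6.3 "Absence of flux anomaly"). Nearest prior art (NOT a match: point
and all dilations vs plane and one dilation) for
`Summit.AnomalousDissipation.AnomalousDissipation.Theses.DyadicWallCascade.HalfSpaceHierarchy`.
[cite: Shvydkoy2018, Lemma 6.1] -/
def shvydkoy2018_lemma61_sphereMoments : Prop :=
  ∀ ⦃α : ℝ⦄ ⦃V : EuclideanSpace ℝ (Fin 3) → EuclideanSpace ℝ (Fin 3)⦄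
    ⦃P : EuclideanSpace ℝ (Fin 3) → ℝ⦄,
    IsHomogeneousSteadyEuler α V P →
    ContDiffOn ℝ ((⊤ : ℕ∞) : WithTop ℕ∞) V {x | x ≠ 0} →
    ContDiffOn ℝ ((⊤ : ℕ∞) : WithTop ℕ∞) P {x | x ≠ 0} →
      (∀ n : ℕ, n ≠ 0 →
        sphereIntegral (volume : Measure (EuclideanSpace ℝ (Fin 3)))
          (fun x => ⟪V x, x⟫ * (‖V x‖ ^ 2 + 2 * P x) ^ n) 1 = 0) ∧
      (α ≠ 2 →
        sphereIntegral (volume : Measure (EuclideanSpace ℝ (Fin 3))) (fun x => ⟪V x, x⟫) 1 = 0)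

/-- **Shvydkoy 2018, Lemma 6.1, case `n = 1`** ("absence of flux anomaly", §6.3): under the named
fact, a smooth homogeneous stationary Euler pair of any degree has `∫_{S²} f H dσ = 0`, i.e. zero
energy flux `Π = -½ ∫_{S²} fH dσ` through the unit sphere. [cite: Shvydkoy2018, Lemma 6.1] -/
theorem shvydkoy2018_lemma61_sphereMoments.flux_moment_eq_zero
    (h : shvydkoy2018_lemma61_sphereMoments)
    {α : ℝ} {V : EuclideanSpace ℝ (Fin 3) → EuclideanSpace ℝ (Fin 3)}
    {P : EuclideanSpace ℝ (Fin 3) → ℝ}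
    (hVP : IsHomogeneousSteadyEuler α V P)
    (hV : ContDiffOn ℝ ((⊤ : ℕ∞) : WithTop ℕ∞) V {x | x ≠ 0})
    (hP : ContDiffOn ℝ ((⊤ : ℕ∞) : WithTop ℕ∞) P {x | x ≠ 0}) :
    sphereIntegral (volume : Measure (EuclideanSpace ℝ (Fin 3)))
      (fun x => ⟪V x, x⟫ * (‖V x‖ ^ 2 + 2 * P x)) 1 = 0 := by
  simpa using (h hVP hV hP).1 1 one_ne_zero

end Literature.Analysis.FluidPDE
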